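import Summits.PneNP.PneNP.Theses.AperiodicTorus
import Literature.Dynamics.Tilings.TorusCNFGluingWidth

/-!
# PneNP / AperiodicTorus — `GluingSubshiftWidth` (item stmt-PneNP-2474)

Route `PneNP/AperiodicTorus`, support item stmt-PneNP-2474
(`Summit.PneNP.PneNP.Theses.AperiodicTorus.GluingSubshiftWidth`, card D2 as a theorem): if the
valid `T`-tilings of `ℤ²` contain a nonempty shift-invariant family `Y` with finite-set gluing at
sup-distance `> g`, then every resolution refutation `π` of the torus CNF `torusCNF n` satisfies
`n ≤ g · (resWidth π + 2)`.

The mathematics is the Literature theorem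
`Literature.Dynamics.Tilings.TorusGluing.resWidth_torusCNF_of_gluing`
(`Literature/Dynamics/Tilings/TorusCNFGluingWidth.lean`: for `g = 0` the torus CNF is
satisfiable; for `g ≥ 1` a Duplicator strategy in the Atserias–Dalmau width game keeps a good lift
of the pebbled cells realised by one tiling of `Y`, re-lifting and gluing the touched clusters when
a new cell is pebbled). This file only identifies the encoding inlined in the item with
`WangTileSet.torusCNF (WangTileSet.ofNESW τ) n` (`WangTileSet.torusCNF_ofNESW`, by `rfl`) and the
inlined hypotheses with `TorusGluing.GluingFamily`.

References: A. Atserias, V. Dalmau, J. Comput. Syst. Sci. 74 (2008) (the width game);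
E. Jeandel, P. Vanier, LNM 2273 (2020), §1 (tilings and tori).
-/

set_option linter.dupNamespace false -- `Summit.PneNP.PneNP.…`: summit = sub-problem (D-0017)

namespace Summit.PneNP.PneNP.Theorems

open Literature.Dynamics.Tilings

/-- **Item stmt-PneNP-2474 (`GluingSubshiftWidth`).** For every tile set given by a colour table
`τ : Fin t → ℕ⁴` and every gap `g`: if the valid tilings of `ℤ²` contain a nonempty
shift-invariant family `Y` with finite-set gluing at sup-distance `> g`, then for every `n ≥ 1`
every resolution refutation `π` of the torus CNF satisfies `n ≤ g · (resWidth π + 2)`.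
Proved by `TorusGluing.resWidth_torusCNF_of_gluing` (which does not even need `n ≥ 1`).
[folklore] -/
theorem aperiodicTorus_gluingSubshiftWidth_proof :
    Summit.PneNP.PneNP.Theses.AperiodicTorus.GluingSubshiftWidth := by
  intro t τ g torusCNF hY n _hn π hπ
  obtain ⟨Y, hne, hval, hshift, hglue⟩ := hY
  exact TorusGluing.resWidth_torusCNF_of_gluing (WangTileSet.ofNESW τ) (Y := Y)
    ⟨hne, hval, hshift, hglue⟩ hπ

end Summit.PneNP.PneNP.Theorems
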